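import Mathlib
import HarnessLib
import Summits.HodgeConjecture.HodgeConjecture.Theorems.HeckePrymWeilSemiregularSpreadOfBlochLifts
import Summits.HodgeConjecture.HodgeConjecture.Theorems.EightfoldBlochSeedsBlochSpreadEightFourSupportAlongChart
import Summits.HodgeConjecture.HodgeConjecture.Theorems.EightfoldBlochSeedsBlochSpreadEightFourCodimOfRegularImmersion
import Summits.HodgeConjecture.HodgeConjecture.Theorems.EightfoldBlochSeedsBlochSpreadEightFourSupportedClass
import Literature.AlgebraicGeometry.HodgeTheory.BlochSemiregularSpread
import Literature.AlgebraicGeometry.HodgeTheory.BlochSemiregularityTheorem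
import Literature.AlgebraicGeometry.HodgeTheory.BlochSemiregularCompIso
import Literature.AlgebraicGeometry.HodgeTheory.RegularImmersionIso
import Literature.AlgebraicGeometry.HodgeTheory.RegularImmersionConormal
import Literature.AlgebraicGeometry.HodgeTheory.ProperOverQuasiProjective
import Literature.AlgebraicGeometry.HodgeTheory.IsoTransport
import Literature.AlgebraicGeometry.HodgeTheory.ClassesSupportedOn

/-!
# Crux `BlochSpreadEightFour` (stmt-HodgeConjecture-18884), line `bloch-lifts-fulton`: the RUNG
# `stub_rung_smoothCentre` (smooth seed) from Bloch's lifting fact and `(SC♯)` — a supported class with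
# non-zero central restriction for a flat family whose central fibre is SMOOTH over `ℂ`

HONEST FRAMING: helper file (route-independent: no `Theses` import); no stub is closed — in particular the
rung `stub_rung_smoothCentre` is NOT closed (it is proved here only under the two displayed hypotheses) —
and nothing here proves `BlochSpreadEightFour`, rung H2, HC_AV or HC. Companion of
`…SpreadOfSupportedClassIntegralFibre.lean` / `…SpreadOfRelativeClassIntegralFibre.lean` (this hand).

For the rung (the crux restricted to a SMOOTH seed `Z`, binder `Smooth (i ≫ X₀.hom)`) Bloch's lift
`𝒵 ⊆ 𝒳 ×_S V` has a central fibre `𝒵_{v₀} ≅ Z` that is SMOOTH over `ℂ` (and integral), so `𝒵 → V`,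
being flat with a smooth fibre, is smooth along the whole (proper) central fibre, hence over a Zariski
neighbourhood of `v₀`: there `𝒵(ℂ) ⊂ (𝒳 ×_S V)(ℂ)` is a closed complex submanifold meeting the fibre
`X₀'(ℂ)` transversally in `Z(ℂ)`. The Fulton-side input the rung needs is therefore only

  `(SC♯)`: as `(SC♭)` (a class on the total space SUPPORTED on the flat family, with non-zero restriction
  to the central fibre, for a flat family with integral scheme-theoretic central fibre of codimension
  exactly `p`), restricted to families whose central fibre `𝒲_{v₀} → Spec ℂ` is moreover SMOOTH

— classically: the Thom class of the closed complex submanifold `𝒲` (near the central fibre; extended by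
excision), whose restriction to the transversal compact fibre is the Thom class of `𝒲_{v₀}`, with image
`cl(𝒲_{v₀}) ≠ 0` in `H²ᵖ(X₀(ℂ))` (Milnor–Stasheff Thm. 10.4 / Fulton §19.2; non-vanishing: the tree's
named fact `map_fundamentalClass_ne_zero_of_height_eq`). What is proved:

* `semiregularSpread_of_blochLifts_of_supportedClassOfSmoothFibre` — the SPREAD glue with inputs
  `Bloch1972_semiregularSubschemeLifts` and `(SC♯)`, for a seed `i₀ : Z₀ ↪ X₀` that is moreover smooth
  over `ℂ` (`Smooth (i₀ ≫ X₀.hom)`): as `semiregularSpread_of_blochLifts_of_supportedClassOfIntegralFibre`,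
  the smoothness of `𝒵_{v₀} → Spec ℂ` being read off `𝒵_{v₀} → X₀' ≅ X₀ = (e.hom ≫ i₀) ≫ …` (Bloch's
  compatibility `he`, `Over.w`).
* `rung_smoothCentre_of_blochLifts_of_supportedClassOfSmoothFibre` — the registered signature of
  `stub_rung_smoothCentre` VERBATIM, from `Bloch1972_semiregularSubschemeLifts` and `(SC♯)`.

References: [Bloch1972Semiregularity] §6, Thm. (7.1), (7.4), Rem. (7.5); Kodaira–Spencer 1959 (semi-regularity);
[BuchweitzFlenner2003] §5; [Fulton1998] §19.1 eq. (1), Lemma 19.1.1, §19.2 Cor. 19.2 (b);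
[Hartshorne1977] III Prop. 9.5, Thm. 10.2; [VoisinHodgeII2003] §3.1.2, §9.2.
-/

-- every declaration of this problem lives in `Summit.HodgeConjecture.HodgeConjecture.…` (summit = sub-problem)
set_option linter.dupNamespace false

noncomputable section

open CategoryTheory CategoryTheory.Limits AlgebraicGeometry MonoidalCategory Order
open Literature.AlgebraicGeometry.Motives Literature.AlgebraicGeometry.HodgeTheory
open Literature.AlgebraicGeometry.Deformation
open Literature.AlgebraicTopology.SingularHomology

namespace Summit.HodgeConjecture.HodgeConjecture.Theorems

/-- **Glue with the rung's Fulton input `(SC♯)` (smooth central fibre).** Granted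
`Bloch1972_semiregularSubschemeLifts` and `(SC♯)`: for a smooth projective family `f : 𝒳 ⟶ S` of relative
dimension `n`, projective in Hartshorne's sense, over a smooth `ℂ`-scheme `S`, a complex point `s₀`, an
integral closed subscheme `i₀ : Z₀ ↪ X₀ = 𝒳_{s₀}`, SMOOTH over `ℂ`, which is a local complete intersection
of codimension exactly `p` and Bloch-semiregular, and a global class `W ∈ H²ᵖ(𝒳(ℂ); ℂ)` of fibrewise Hodge type `(p,p)`
whose restriction to `X₀` is supported on `Z₀`, the restriction `W|_{𝒳_t}` is algebraic for every `t` in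
an open neighbourhood of `s₀` in `S(ℂ)`. Proof: as `semiregularSpread_of_blochLifts_of_supportedClassOfIntegralFibre`,
the class `Γ` being taken from `(SC♯)` applied to Bloch's flat lift `𝒵 ⊆ 𝒳 ×_S V`, whose scheme-theoretic
central fibre is integral and smooth over `ℂ` because it is isomorphic (Bloch's `e`, compatibly with the
maps to `𝒳`) to `Z₀`.
[cite: Bloch1972Semiregularity, Thm. (7.1), proof of Thm. (7.4) (pp. 64–65), Remark (7.5)]
[cite: BuchweitzFlenner2003, §5, end of the proof of Thm. 5.1 / Thm. 5.2]
[cite: Fulton1998, §10.1 Prop. 10.1 (a); §19.1 eq. (1) and Lemma 19.1.1] [cite: VoisinHodgeII2003, §3.1.2] -/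
theorem semiregularSpread_of_blochLifts_of_supportedClassOfSmoothFibre
    (hB : Bloch1972_semiregularSubschemeLifts)
    (hSC : ∀ ⦃n p : ℕ⦄ ⦃𝒳 V : SchemeOver ℂ⦄ (g : 𝒳 ⟶ V), 0 < p → IsSmoothProjectiveFamily g n →
      AlgebraicGeometry.Smooth V.hom →
      ∀ (𝒲 : Scheme) (ι : 𝒲 ⟶ 𝒳.left), IsClosedImmersion ι → Flat (ι ≫ g.left) →
      ∀ (v₀ : ComplexPoints V), AlgebraicGeometry.IsIntegral (pullback ι (fiberι g v₀).left) →
      AlgebraicGeometry.Smooth (pullback.snd ι (fiberι g v₀).left ≫ (fiberOver g v₀).hom) →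
      (∀ z : ↥(pullback ι (fiberι g v₀).left),
        (p : ℕ∞) ≤ Order.coheight ((pullback.snd ι (fiberι g v₀).left).base z)) →
      (∃ z : ↥(pullback ι (fiberι g v₀).left),
        Order.coheight ((pullback.snd ι (fiberι g v₀).left).base z) = (p : ℕ∞)) →
      ∃ Γ : complexBetti 𝒳 (2 * p),
        Γ ∈ classesSupportedOn 𝒳 (Set.range ι.base) (2 * p) ∧
        complexBetti.map (fiberι g v₀) (2 * p) Γ ≠ 0)
    {𝒳 S : SchemeOver ℂ} (f : 𝒳 ⟶ S) (n p : ℕ) (hf : IsSmoothProjectiveFamily f n)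
    (hproj : ∃ (N : ℕ) (ε : 𝒳 ⟶ projectiveSpace N ℂ ⊗ S), IsClosedImmersion ε.left ∧
      ε ≫ CartesianMonoidalCategory.snd (projectiveSpace N ℂ) S = f)
    (hS : AlgebraicGeometry.Smooth S.hom)
    (s₀ : ComplexPoints S) (Z₀ : Scheme) (i₀ : Z₀ ⟶ (fiberOver f s₀).left)
    (hi₀ : IsClosedImmersion i₀) (hlci : IsFiniteLocallyFree (conormalSheaf i₀))
    (hint : AlgebraicGeometry.IsIntegral Z₀)
    (hsm : AlgebraicGeometry.Smooth (i₀ ≫ (fiberOver f s₀).hom))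
    (hcoh : ∀ z : Z₀, (p : ℕ∞) ≤ Order.coheight (i₀.base z))
    (hcohp : ∃ z : Z₀, Order.coheight (i₀.base z) = (p : ℕ∞))
    (hsr : IsBlochSemiregular i₀ n p)
    (W : complexBetti 𝒳 (2 * p))
    (hW : ∀ s : ComplexPoints S,
      IsOfHodgeType n (fiberOver f s) (2 * p) p p (complexBetti.map (fiberι f s) (2 * p) W))
    (hsupp : complexBetti.map (fiberι f s₀) (2 * p) W ∈
      classesSupportedOn (fiberOver f s₀) (Set.range i₀.base) (2 * p)) :
    ∃ U : Set (ComplexPoints S), IsOpen U ∧ s₀ ∈ U ∧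
      ∀ t ∈ U, complexBetti.map (fiberι f t) (2 * p) W ∈ algebraicClasses (fiberOver f t) p := by
  haveI := hS
  haveI := hi₀
  haveI := hint
  -- codimension `0`: every class is algebraic
  rcases Nat.eq_zero_or_pos p with rfl | hp
  · exact ⟨Set.univ, isOpen_univ, Set.mem_univ _, fun t _ => by
      rw [algebraicClasses_zero]; trivial⟩
  -- `W|_{X₀} = 0`: rigidity of the flat section near `s₀`
  by_cases h0 : complexBetti.map (fiberι f s₀) (2 * p) W = 0
  · obtain ⟨U, hU, hs₀U, hrig⟩ := exists_isOpen_forall_map_fiberι_eq_zero f hf s₀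
    refine ⟨{t | t.pt ∈ U}, AlgPoints.isOpen_setOf_pt_mem (X := S) (L := ℂ) ⟨U, hU⟩, hs₀U,
      fun t ht => ?_⟩
    rw [hrig (2 * p) W h0 t ht]
    exact Submodule.zero_mem _
  -- the generic point `η` of the integral `Z₀` has codimension exactly `p` in `X₀` …
  haveI : IrreducibleSpace Z₀ := inferInstance
  set η : Z₀ := genericPoint Z₀ with hηdef
  have hη : Order.coheight (i₀.base η) = (p : ℕ∞) := by
    obtain ⟨z₁, hz₁⟩ := hcohp
    refine le_antisymm ?_ (hcoh η)
    rw [← hz₁]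
    exact Order.coheight_anti (Scheme.le_iff_specializes.2
      ((genericPoint_specializes z₁).map i₀.continuous))
  -- … and every point of codimension `p` of `Z₀` has closure `⊇ Z₀` in `X₀` (it is `η`)
  have hgen : ∀ z : Z₀, Order.coheight (i₀.base z) = (p : ℕ∞) →
      Set.range i₀.base ⊆ closure {i₀.base z} := by
    intro z hz
    have hle : i₀.base z ≤ i₀.base η :=
      Scheme.le_iff_specializes.2 ((genericPoint_specializes z).map i₀.continuous)
    have hsp : i₀.base z ⤳ i₀.base η := by
      by_contra hne
      have hlt : i₀.base z < i₀.base η :=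
        lt_of_le_not_ge hle (fun h => hne (Scheme.le_iff_specializes.1 h))
      have := Order.coheight_strictAnti hlt (by rw [hη]; exact ENat.coe_lt_top p)
      rw [hη, hz] at this
      exact lt_irrefl _ this
    have hcl : closure {i₀.base η} = Set.range i₀.base := by
      rw [← Set.image_singleton, i₀.isClosedEmbedding.closure_image_eq, hηdef,
        genericPoint_closure, Set.image_univ]
    rw [← hcl]
    exact specializes_iff_closure_subset.1 hsp
  -- Bloch: the semiregular lci `Z₀` lifts to a flat family over a smooth `π : V ⟶ S` through `s₀`
  have hpure : ∀ z : Z₀, ∃ z' : Z₀, Order.coheight (i₀.base z') = (p : ℕ∞) ∧ i₀.base z' ⤳ i₀.base z :=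
    fun z => ⟨η, hη, (genericPoint_specializes z).map i₀.continuous⟩
  have hclass : ∀ z : Z₀, Order.coheight (i₀.base z) = (p : ℕ∞) →
      SupportClassStaysHodge f n p s₀ (closure {i₀.base z}) :=
    fun z hz => (SupportClassStaysHodge.intro W hW hsupp h0).mono (hgen z hz)
  obtain ⟨V, π, hπ, v₀, hv₀, 𝒵, ι, hι, hflat, e, he⟩ :=
    hB.of_smooth f n p hf hproj hS s₀ Z₀ i₀ hi₀ hlci hpure hclass hsr
  subst hv₀
  haveI := hπ
  haveI := hι
  haveI := hflat
  haveI : AlgebraicGeometry.Smooth V.hom := by rw [← Over.w π]; infer_instance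
  have hg : IsSmoothProjectiveFamily (familyPullback.snd f π) n := hf.familyPullback_snd π
  -- `θ : X₀' ≅ X₀`, the fibre of the base change over `v₀` and the fibre of `f` over `π v₀`
  set θ := fiberOverFamilyPullbackIso f π v₀ with hθdef
  have hhi : ∀ y, θ.hom.left.base (θ.inv.left.base y) = y := fun y => by
    rw [← Scheme.Hom.comp_apply, ← Over.comp_left, θ.inv_hom_id]; rfl
  have hih : ∀ x, θ.inv.left.base (θ.hom.left.base x) = x := fun x => by
    rw [← Scheme.Hom.comp_apply, ← Over.comp_left, θ.hom_inv_id]; rfl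
  -- the transported set `W₀' = θ⁻¹(Z₀)` on `X₀'`
  set W₀' : Set (fiberOver (familyPullback.snd f π) v₀).left := θ.hom.left.base ⁻¹' Set.range i₀.base
    with hW₀'
  have hW₀'c : IsClosed W₀' := i₀.isClosedEmbedding.isClosed_range.preimage θ.hom.left.continuous
  have hW₀'i : IsIrreducible W₀' := by
    have : W₀' = (fun w => θ.inv.left.base (i₀.base w)) '' Set.univ := by
      ext x
      simp only [hW₀', Set.mem_preimage, Set.mem_range, Set.image_univ]
      constructor
      · rintro ⟨w, hw⟩
        exact ⟨w, by rw [hw, hih]⟩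
      · rintro ⟨w, rfl⟩
        exact ⟨w, (hhi _).symm⟩
    rw [this]
    exact (IrreducibleSpace.isIrreducible_univ _).image _ (by fun_prop : Continuous _).continuousOn
  -- the central fibre of the flat family is `W₀'`
  have hsnd : pullback.snd ι (fiberι (familyPullback.snd f π) v₀).left ≫ θ.hom.left = e.hom ≫ i₀ := by
    haveI : Subsingleton ↥((specOver ℂ ℂ).left) := inferInstanceAs (Subsingleton (PrimeSpectrum ℂ))
    haveI : IsClosedImmersion (AlgPoints.map π v₀).left :=
      isClosedImmersion_of_comp_eq_id _ _ (ComplexPoints.toSpecHom_comp_hom (AlgPoints.map π v₀))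
    haveI : Mono (fiberι f (AlgPoints.map π v₀)).left := by
      change Mono (pullback.fst f.left (AlgPoints.map π v₀).left); infer_instance
    rw [← cancel_mono (fiberι f (AlgPoints.map π v₀)).left, Category.assoc, Category.assoc,
      ← Over.comp_left, hθdef, fiberOverFamilyPullbackIso_hom_fiberι, Over.comp_left,
      ← Category.assoc, ← pullback.condition, Category.assoc]
    exact he
  have hrange : Set.range (pullback.snd ι (fiberι (familyPullback.snd f π) v₀).left).base = W₀' := by
    have key : ∀ z, θ.hom.left.base ((pullback.snd ι (fiberι (familyPullback.snd f π) v₀).left).base z) =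
        i₀.base (e.hom.base z) := fun z => by
      rw [← Scheme.Hom.comp_apply, hsnd, Scheme.Hom.comp_apply]
    ext x
    constructor
    · rintro ⟨z, rfl⟩
      exact ⟨e.hom.base z, (key z).symm⟩
    · rintro ⟨z₀, hz₀⟩
      obtain ⟨z, rfl⟩ := e.hom.surjective z₀
      exact ⟨z, by rw [← hih ((pullback.snd ι (fiberι (familyPullback.snd f π) v₀).left).base z),
          key, hz₀, hih]⟩
  have hcoh' : ∀ z ∈ W₀', (p : ℕ∞) ≤ Order.coheight z := by
    intro z hz
    obtain ⟨w, hw⟩ := hz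
    rw [← coheight_left_base_eq_of_iso θ z, ← hw]
    exact hcoh w
  -- the scheme-theoretic central fibre `𝒵_{v₀} ≅ Z₀` is integral, of codimension exactly `p` in `X₀'`
  haveI : Nonempty ↥(pullback ι (fiberι (familyPullback.snd f π) v₀).left) := ⟨e.inv.base η⟩
  have hintP : AlgebraicGeometry.IsIntegral (pullback ι (fiberι (familyPullback.snd f π) v₀).left) :=
    isIntegral_of_isOpenImmersion e.hom
  have hcohP : ∀ z : ↥(pullback ι (fiberι (familyPullback.snd f π) v₀).left),
      (p : ℕ∞) ≤ Order.coheight ((pullback.snd ι (fiberι (familyPullback.snd f π) v₀).left).base z) :=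
    fun z => hcoh' _ (hrange ▸ ⟨z, rfl⟩)
  have hcohP2 : ∃ z : ↥(pullback ι (fiberι (familyPullback.snd f π) v₀).left),
      Order.coheight ((pullback.snd ι (fiberι (familyPullback.snd f π) v₀).left).base z) = (p : ℕ∞) := by
    refine ⟨e.inv.base η, ?_⟩
    have key : θ.hom.left.base ((pullback.snd ι (fiberι (familyPullback.snd f π) v₀).left).base
        (e.inv.base η)) = i₀.base η := by
      rw [← Scheme.Hom.comp_apply (pullback.snd ι _) θ.hom.left, hsnd, Scheme.Hom.comp_apply,
        ← Scheme.Hom.comp_apply e.inv e.hom, e.inv_hom_id]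
      rfl
    rw [← coheight_left_base_eq_of_iso θ, key, hη]
  -- the central fibre `𝒵_{v₀} → X₀' ≅ X₀` is `e.hom ≫ i₀`, hence SMOOTH over `ℂ`
  have hsmP : AlgebraicGeometry.Smooth
      (pullback.snd ι (fiberι (familyPullback.snd f π) v₀).left ≫
        (fiberOver (familyPullback.snd f π) v₀).hom) := by
    have hfac : pullback.snd ι (fiberι (familyPullback.snd f π) v₀).left ≫
        (fiberOver (familyPullback.snd f π) v₀).hom =
          e.hom ≫ (i₀ ≫ (fiberOver f (AlgPoints.map π v₀)).hom) := by
      rw [← Over.w θ.hom, ← Category.assoc, hsnd, Category.assoc]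
    rw [hfac]
    haveI := hsm
    infer_instance
  -- the supported class of the flat family (hypothesis `(SC♯)`)
  obtain ⟨Γ, hΓsupp, hw0⟩ :=
    hSC (p := p) (familyPullback.snd f π) hp hg ‹_› 𝒵 ι hι hflat v₀ hintP hsmP hcohP hcohP2
  -- (F3)+(F4)+(F4′): algebraic fibre restrictions over a Zariski neighbourhood `U₁` of `v₀`
  haveI := hg.smooth
  haveI : UniversallyClosed (familyPullback.snd f π).left := by haveI := hg.isProper; infer_instance
  haveI : IsLocallyNoetherian V.left := LocallyOfFiniteType.isLocallyNoetherian V.hom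
  haveI : IsLocallyNoetherian (familyPullback f π).left :=
    LocallyOfFiniteType.isLocallyNoetherian (familyPullback.snd f π).left
  haveI : IsLocallyNoetherian 𝒵 := LocallyOfFiniteType.isLocallyNoetherian ι
  have hXreg : ∀ x : (familyPullback f π).left, (familyPullback.snd f π).left.base x = v₀.pt →
      IsRegularLocalRing ((familyPullback f π).left.presheaf.stalk x) :=
    fun x _ => isRegularLocalRing_stalk_of_isSmoothProjectiveFamily hg x
  have hW₀eq : W₀' = (fiberι (familyPullback.snd f π) v₀).left.base ⁻¹' Set.range ι.base := by
    rw [← hrange, Scheme.Pullback.range_snd]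
  have hcodim'' : ∀ z : (fiberOver (familyPullback.snd f π) v₀).left,
      (fiberι (familyPullback.snd f π) v₀).left.base z ∈ Set.range ι.base →
        (p : ℕ∞) ≤ Order.coheight z :=
    fun z hz' => hcoh' z (by rw [hW₀eq]; exact hz')
  obtain ⟨U₁, hU₁, hv₀U₁, hΓ⟩ :=
    exists_isOpen_forall_map_fiberι_mem_algebraicClasses_of_flat_family (familyPullback.snd f π) ι v₀
      hXreg hcodim'' hΓsupp
  set w := complexBetti.map (fiberι (familyPullback.snd f π) v₀) (2 * p) Γ with hwdef
  have hw : w ∈ classesSupportedOn (fiberOver (familyPullback.snd f π) v₀) W₀' (2 * p) := by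
    rw [hwdef, hW₀eq]
    exact mem_classesSupportedOn_map_preimage (fiberι (familyPullback.snd f π) v₀) hΓsupp
  -- purity: the classes supported on `W₀'` form a line, so `θ^* (W|_{X₀}) = λ • w`, `λ ≠ 0`
  obtain ⟨τ, hτ⟩ := exists_ker_restrictCompl_le_span_of_isIrreducible (hg.isSmoothProjective v₀)
    hW₀'c hW₀'i (c := p) hp hcoh'
  set x₀ := complexBetti.map (fiberι f (AlgPoints.map π v₀)) (2 * p) W with hx₀def
  have hx₀' : complexBetti.map θ.hom (2 * p) x₀ ∈ classesSupportedOn _ W₀' (2 * p) :=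
    mem_classesSupportedOn_iff.2
      (complexBetti.restrictCompl_map_eq_zero θ.hom (mem_classesSupportedOn_iff.1 hsupp))
  obtain ⟨lam, hlam⟩ : ∃ lam : ℂ, complexBetti.map θ.hom (2 * p) x₀ = lam • w := by
    obtain ⟨a, ha⟩ := Submodule.mem_span_singleton.1 (hτ hw)
    obtain ⟨b, hb⟩ := Submodule.mem_span_singleton.1 (hτ hx₀')
    have ha0 : a ≠ 0 := by
      rintro rfl
      exact hw0 (by rw [← ha, zero_smul])
    exact ⟨b / a, by rw [← hb, ← ha, smul_smul, div_mul_cancel₀ b ha0]⟩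
  have hlam0 : lam ≠ 0 := by
    rintro rfl
    rw [zero_smul] at hlam
    exact h0 ((complexBetti.bijective_map_of_iso θ (2 * p)).1 (by rw [hlam, map_zero]))
  -- the global class `Θ := pr^* W - λ • Γ` on `𝒳 ×_S V` vanishes on `X₀'`
  set Θ : complexBetti (familyPullback f π) (2 * p) :=
    complexBetti.map (familyPullback.fst f π) (2 * p) W - lam • Γ with hΘ
  have hΘ0 : complexBetti.map (fiberι (familyPullback.snd f π) v₀) (2 * p) Θ = 0 := by
    rw [hΘ, map_sub, map_smul, map_fiberι_familyPullback, ← hθdef, ← hx₀def, hlam, hwdef, sub_self]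
  -- rigidity over a Zariski neighbourhood `U` of `v₀`: there `pr^* W|_{X_{t'}} = λ • Γ|_{X_{t'}}`
  obtain ⟨U, hU, hv₀U, hrig⟩ := exists_isOpen_forall_map_fiberι_eq_zero (familyPullback.snd f π) hg v₀
  have halg : ∀ t' : ComplexPoints V, t'.pt ∈ U ∩ U₁ →
      complexBetti.map (fiberι f (AlgPoints.map π t')) (2 * p) W ∈
        algebraicClasses (fiberOver f (AlgPoints.map π t')) p := by
    intro t' ht'
    rw [← map_fiberι_familyPullback_mem_algebraicClasses_iff f π hf W t']
    have hM := hrig (2 * p) Θ hΘ0 t' ht'.1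
    rw [hΘ, map_sub, map_smul, sub_eq_zero] at hM
    rw [hM]
    exact Submodule.smul_mem _ _ (hΓ t' ht'.2)
  -- the image `π(U ∩ U₁)` is a Zariski neighbourhood of `pt s₀`, and complex points over it lift
  haveI : LocallyOfFiniteType S.hom := inferInstance
  haveI : LocallyOfFiniteType π.left := inferInstance
  have hπU : IsOpen ((π.left : V.left → S.left) '' (U ∩ U₁)) := π.left.isOpenMap _ (hU.inter hU₁)
  refine ⟨{t | t.pt ∈ (π.left : V.left → S.left) '' (U ∩ U₁)},
    AlgPoints.isOpen_setOf_pt_mem (X := S) (L := ℂ) ⟨_, hπU⟩, ⟨v₀.pt, ⟨hv₀U, hv₀U₁⟩, rfl⟩,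
    fun t ht => ?_⟩
  obtain ⟨t', ht'U, rfl⟩ := exists_complexPoints_map_eq_of_pt_mem_image π (hU.inter hU₁) t ht
  exact halg t' ht'U


/-- **The RUNG `stub_rung_smoothCentre` from Bloch's lifting fact and `(SC♯)`** — the registered signature of
`stub_rung_smoothCentre` (the crux `BlochSemiregularSpread (2 * 4) 4` restricted to a SMOOTH seed `Z`,
binder `Smooth (i ≫ X₀.hom)`) VERBATIM as conclusion: transport the seed along the chart `e : X₀ ≅ 𝒳_{s₀}`
(`IsRegularImmersionOfCodim.comp_iso`, `IsBlochSemiregular.comp_iso`, `coheight_left_base_eq_of_iso`,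
`Over.w e.hom` for the smoothness of `Z → Spec ℂ`), read the codimension-`4` generic point (landed
`stub_codimOfRegularImmersion`) and the support (landed `stub_supportAlongChart`) in the fibre, Hartshorne
projectivity of `f`, then `semiregularSpread_of_blochLifts_of_supportedClassOfSmoothFibre`. Conditional on
the two displayed hypotheses; the rung stub is NOT closed by this theorem.
[cite: Bloch1972Semiregularity, §6 and Thm. (7.4)]
[cite: Fulton1998, §19.1 eq. (1) and §19.2 Cor. 19.2 (b)] -/
theorem rung_smoothCentre_of_blochLifts_of_supportedClassOfSmoothFibre
    (hB : Bloch1972_semiregularSubschemeLifts)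
    (hSC : ∀ ⦃n p : ℕ⦄ ⦃𝒳 V : SchemeOver ℂ⦄ (g : 𝒳 ⟶ V), 0 < p → IsSmoothProjectiveFamily g n →
      AlgebraicGeometry.Smooth V.hom →
      ∀ (𝒲 : Scheme) (ι : 𝒲 ⟶ 𝒳.left), IsClosedImmersion ι → Flat (ι ≫ g.left) →
      ∀ (v₀ : ComplexPoints V), AlgebraicGeometry.IsIntegral (pullback ι (fiberι g v₀).left) →
      AlgebraicGeometry.Smooth (pullback.snd ι (fiberι g v₀).left ≫ (fiberOver g v₀).hom) →
      (∀ z : ↥(pullback ι (fiberι g v₀).left),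
        (p : ℕ∞) ≤ Order.coheight ((pullback.snd ι (fiberι g v₀).left).base z)) →
      (∃ z : ↥(pullback ι (fiberι g v₀).left),
        Order.coheight ((pullback.snd ι (fiberι g v₀).left).base z) = (p : ℕ∞)) →
      ∃ Γ : complexBetti 𝒳 (2 * p),
        Γ ∈ classesSupportedOn 𝒳 (Set.range ι.base) (2 * p) ∧
        complexBetti.map (fiberι g v₀) (2 * p) Γ ≠ 0) :
    ∀ (X₀ : SchemeOver ℂ) (Z : Scheme.{0}) (i : Z ⟶ X₀.left) (x : complexBetti X₀ (2 * 4))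
      (𝒳 S : SchemeOver ℂ) (f : 𝒳 ⟶ S) (s₀ : ComplexPoints S) (e : X₀ ≅ fiberOver f s₀)
      (W : complexBetti 𝒳 (2 * 4)),
      AlgebraicGeometry.Smooth (i ≫ X₀.hom) →
      IsClosedImmersion i → IsRegularImmersionOfCodim i 4 → AlgebraicGeometry.IsIntegral Z →
      (∀ z ∈ Set.range i.base, ((4 : ℕ) : ℕ∞) ≤ Order.coheight z) →
      IsBlochSemiregular i (2 * 4) 4 →
      x ∈ classesSupportedOn X₀ (Set.range i.base) (2 * 4) →
      IsSmoothProjectiveFamily f (2 * 4) → IsQuasiProjectiveOver 𝒳 → IsQuasiProjectiveOver S →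
      AlgebraicGeometry.Smooth S.hom →
      (∀ s : ComplexPoints S, IsRationalClass (complexBetti.map (fiberι f s) (2 * 4) W) ∧
        IsOfHodgeType (2 * 4) (fiberOver f s) (2 * 4) 4 4 (complexBetti.map (fiberι f s) (2 * 4) W)) →
      complexBetti.map e.hom (2 * 4) (complexBetti.map (fiberι f s₀) (2 * 4) W) = x →
      ∃ U : Set (ComplexPoints S), IsOpen U ∧ s₀ ∈ U ∧
        ∀ t ∈ U, complexBetti.map (fiberι f t) (2 * 4) W ∈ algebraicClasses (fiberOver f t) 4 := by
  intro X₀ Z i x 𝒳 S f s₀ e W hZsm hi hreg hZ hcodim hsr hsupp hf h𝒳 hS hSm hW hx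
  -- the central fibre is smooth projective, hence locally Noetherian; `Z` is integral
  haveI : IsLocallyNoetherian (fiberOver f s₀).left :=
    IsSmoothProjective.isLocallyNoetherian_holds (hf.isSmoothProjective s₀)
  haveI := hZ
  -- transport the seed along the chart `e : X₀ ≅ 𝒳_{s₀}`
  have hreg' : IsRegularImmersionOfCodim (i ≫ e.hom.left) 4 := hreg.comp_iso (leftIso e)
  haveI : IsClosedImmersion (i ≫ e.hom.left) := hreg'.isClosedImmersion
  have hlci : IsFiniteLocallyFree (conormalSheaf (i ≫ e.hom.left)) :=
    hreg'.isFiniteLocallyFree_conormalSheaf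
  have hsr' : IsBlochSemiregular (i ≫ e.hom.left) (2 * 4) 4 := IsBlochSemiregular.comp_iso e i hsr
  have hsm' : AlgebraicGeometry.Smooth ((i ≫ e.hom.left) ≫ (fiberOver f s₀).hom) := by
    rw [Category.assoc, Over.w e.hom]
    exact hZsm
  have hcoh : ∀ z : Z, ((4 : ℕ) : ℕ∞) ≤ Order.coheight ((i ≫ e.hom.left).base z) := by
    intro z
    have h1 : (i ≫ e.hom.left).base z = e.hom.left.base (i.base z) := rfl
    rw [h1, coheight_left_base_eq_of_iso e (i.base z)]
    exact hcodim _ ⟨z, rfl⟩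
  have hcohp : ∃ z : Z, Order.coheight ((i ≫ e.hom.left).base z) = ((4 : ℕ) : ℕ∞) :=
    stub_codimOfRegularImmersion (i ≫ e.hom.left) 4 hreg'
  -- Hartshorne projectivity of `f`
  have hproj :=
    IsQuasiProjectiveOver.exists_isClosedImmersion_projectiveSpace_tensor_of_isSmoothProjectiveFamily f hf h𝒳
  -- the support of `W|_{X₀}` read in the fibre
  have hsupp' : complexBetti.map (fiberι f s₀) (2 * 4) W ∈
      classesSupportedOn (fiberOver f s₀) (Set.range (i ≫ e.hom.left).base) (2 * 4) :=
    stub_supportAlongChart e i (2 * 4) _ (hx ▸ hsupp)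
  exact semiregularSpread_of_blochLifts_of_supportedClassOfSmoothFibre hB hSC f (2 * 4) 4 hf hproj hSm
    s₀ Z (i ≫ e.hom.left) inferInstance hlci hZ hsm' hcoh hcohp hsr' W (fun s => (hW s).2) hsupp'

end Summit.HodgeConjecture.HodgeConjecture.Theorems

end
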